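import Literature.MathematicalPhysics.QuantumLattice.SchwartzNuclearExpansion
import HarnessLib

/-!
# A nuclear expansion of the Schwartz space: the summability estimate

Trunk **T-AQFT** (topic `MathematicalPhysics/QuantumLattice`), families `constructive-qft`,
`crit-ising`; companion of `SchwartzNuclearExpansion` in the discharge of
`Literature.MathematicalPhysics.QuantumLattice.SchwingerFamily.HasProductGrowth.hasLinearGrowth`
(Osterwalder–Schrader II, Appendix: E0'' implies E0').

For the expansion `ψ = lim_R ∑_{β ∈ [-R,R]ᵐ} ∑_k coeff_{β,k}(ψ) e_{β,k}` of `SchwartzNuclearExpansion`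
we prove the estimate that makes it *nuclear*: for every order `s` there are an order `t` and
nonnegative weights `L_{β,k}` with

  `‖coeff_{β,k}(ψ)‖ ≤ L_{β,k} |ψ|_t` and `∑_{β,k} L_{β,k} |e_{β,k}|_s < ∞`

(`NuclearExpansion.exists_summable_bound`; `|·|_t = schwartzNorm t`, the Schwartz norm of order
`t` of `SchwingerOSAxioms`). Ingredients: the Schwartz norms of the elementary functions grow
polynomially, `|e_{β,k}|_s ≤ C (1 + |k|₁)^s (1 + ‖Λ⁻¹β‖)^s` (`schwartzNorm_e_le`: Leibniz rule with
the window and `‖Dʲ e_k‖ ≤ (2π|k|₁‖L‖)ʲ`, and polynomial growth of translates); the coefficients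
decay faster than any power, `‖coeff_{β,k}(ψ)‖ (1 + |k|₁)^N (1 + ‖Λ⁻¹β‖)^N ≤ C |ψ|_t`
(`norm_coeff_mul_pow_le`: Schwartz decay of the Fourier transform, continuity of `𝓕` on `𝓢`,
and the decay of the localised pieces `η_β ψ` of a Schwartz function far from the origin,
`exists_bound_sup_seminorm_smulLeftCLM_compSubConstCLM` of `SchwartzPartition`); and
`∑_{n ∈ ℤᵐ} ∏_c (1 + |n_c|)⁻² < ∞`. In Summers' Hermite proof these are the polynomial growth of
`|H_i|_r` ((A4)–(A5)) and the decay of the Hermite coefficients ((A6)).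

## Sources

* K. Osterwalder, R. Schrader, *Axioms for Euclidean Green's functions II*, Comm. Math. Phys.
  42 (1975) 281–305, Appendix (S. Summers), pp. 303–305, (A3)–(A6). [OsterwalderSchraderCMP1975]
* The estimates themselves are folklore (elementary proofs of the nuclearity of `𝒮`).

## Mathlib and Literature

Used from Mathlib: `Seminorm.bound_of_continuous` (continuity of `𝓕` on `𝓢` in seminorm form),
`SchwartzMap.one_add_le_sup_seminorm_apply`, `ContinuousLinearMap.iteratedFDeriv_comp_right`,
`Summable.mul_of_nonneg`, `Summable.of_nonneg_of_le`. From the tree: `schwartzNorm`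
(`SchwingerOSAxioms`), `seminorm_compSubConstCLM_le`,
`exists_bound_sup_seminorm_smulLeftCLM_compSubConstCLM` (`SchwartzPartition`),
`pow_mul_norm_iteratedFDeriv_mul_le`, `norm_iteratedFDeriv_eChar_affine_le`,
`absSum_le_card_mul_norm`, `abs_le_norm_intVec`, `summable_pi_inv_one_add_abs_sq`
(`SchwartzFourierDensity`).
-/

open scoped SchwartzMap Real FourierTransform Topology ContDiff
open Filter Set

noncomputable section

namespace Literature.MathematicalPhysics.QuantumLattice

namespace NuclearExpansion

/-! ### Generic Schwartz-norm estimates -/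

section Generic

variable {V : Type*} [NormedAddCommGroup V] [NormedSpace ℝ V]
variable {D : Type*} [NormedAddCommGroup D] [NormedSpace ℝ D]

/-- A finite family of Schwartz seminorms is dominated by a Schwartz norm of finite order. [folklore] -/
theorem sup_seminorm_le_schwartzNorm (s : Finset (ℕ × ℕ)) :
    ∃ M : ℕ, ∀ f : 𝓢(V, ℂ), (s.sup (schwartzSeminormFamily ℂ V ℂ)) f ≤ schwartzNorm M f := by
  refine ⟨max (s.sup Prod.fst) (s.sup Prod.snd), fun f => ?_⟩
  have hsub : s ⊆ Finset.Iic (max (s.sup Prod.fst) (s.sup Prod.snd), max (s.sup Prod.fst) (s.sup Prod.snd)) :=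
    fun i hi => Finset.mem_Iic.2 (Prod.mk_le_mk.2
      ⟨(Finset.le_sup (f := Prod.fst) hi).trans (le_max_left _ _),
        (Finset.le_sup (f := Prod.snd) hi).trans (le_max_right _ _)⟩)
  exact Seminorm.le_def.1 (Finset.sup_mono (f := schwartzSeminormFamily ℂ V ℂ) hsub) f

/-- **Schwartz norms of translates grow polynomially**: `|f(· - a)|_M ≤ (2(1 + ‖a‖))^M |f|_M`
(`seminorm_compSubConstCLM_le`). [folklore] -/
theorem schwartzNorm_compSubConstCLM_le (M : ℕ) (a : V) (f : 𝓢(V, ℂ)) :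
    schwartzNorm M (SchwartzMap.compSubConstCLM ℂ a f) ≤ (2 * (1 + ‖a‖)) ^ M * schwartzNorm M f := by
  have h1 : (1 : ℝ) ≤ 2 * (1 + ‖a‖) := by nlinarith [norm_nonneg a]
  refine Seminorm.finset_sup_apply_le (mul_nonneg (by positivity) (schwartzNorm_nonneg _ _))
    fun i hi => ?_
  obtain ⟨hk, hl⟩ := Prod.mk_le_mk.1 (Finset.mem_Iic.1 hi)
  rw [SchwartzMap.schwartzSeminormFamily_apply]
  refine (seminorm_compSubConstCLM_le ℂ i.1 i.2 a f).trans ?_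
  exact mul_le_mul (pow_le_pow_right₀ h1 hk) (sup_Iic_schwartzSeminorm_mono ℂ hk hl f)
    (apply_nonneg _ _) (by positivity)

/-- **Schwartz norms under a linear change of variables**: `|f ∘ g|_M ≤ c^{2M} |f|_M` with
`c = max 1 (max ‖g⁻¹‖ ‖g‖)` (chain rule `Dˡ(f ∘ g) = Dˡf ∘ (g, …, g)`). [folklore] -/
theorem schwartzNorm_compCLMOfContinuousLinearEquiv_le (M : ℕ) (g : D ≃L[ℝ] V) (f : 𝓢(V, ℂ)) :
    schwartzNorm M (SchwartzMap.compCLMOfContinuousLinearEquiv ℂ g f) ≤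
      (max 1 (max ‖(g.symm : V →L[ℝ] D)‖ ‖(g : D →L[ℝ] V)‖)) ^ (2 * M) * schwartzNorm M f := by
  set c : ℝ := max 1 (max ‖(g.symm : V →L[ℝ] D)‖ ‖(g : D →L[ℝ] V)‖) with hc
  have hc1 : 1 ≤ c := le_max_left _ _
  have hc0 : 0 ≤ c := zero_le_one.trans hc1
  refine Seminorm.finset_sup_apply_le (mul_nonneg (by positivity) (schwartzNorm_nonneg _ _))
    fun i hi => ?_
  obtain ⟨hk, hl⟩ := Prod.mk_le_mk.1 (Finset.mem_Iic.1 hi)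
  rw [SchwartzMap.schwartzSeminormFamily_apply]
  refine SchwartzMap.seminorm_le_bound ℂ i.1 i.2 _ (mul_nonneg (by positivity)
    (schwartzNorm_nonneg _ _)) fun x => ?_
  rw [SchwartzMap.compCLMOfContinuousLinearEquiv_apply,
    show ((f : V → ℂ) ∘ (g : D → V)) = (f : V → ℂ) ∘ ((g : D →L[ℝ] V) : D → V) from rfl,
    (g : D →L[ℝ] V).iteratedFDeriv_comp_right (f.smooth ⊤) x (i := i.2) (mod_cast le_top)]
  have hD : ‖(iteratedFDeriv ℝ i.2 f (g x)).compContinuousLinearMap fun _ => (g : D →L[ℝ] V)‖ ≤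
      ‖iteratedFDeriv ℝ i.2 f (g x)‖ * c ^ i.2 := by
    refine (ContinuousMultilinearMap.norm_compContinuousLinearMap_le _ _).trans ?_
    rw [Finset.prod_const, Finset.card_univ, Fintype.card_fin]
    gcongr
    exact (le_max_right _ _).trans (le_max_right _ _)
  have hx : ‖x‖ ≤ c * ‖g x‖ := by
    calc ‖x‖ = ‖g.symm (g x)‖ := by rw [ContinuousLinearEquiv.symm_apply_apply]
      _ ≤ ‖(g.symm : V →L[ℝ] D)‖ * ‖g x‖ := g.symm.toContinuousLinearMap.le_opNorm _
      _ ≤ c * ‖g x‖ := by gcongr; exact (le_max_left _ _).trans (le_max_right _ _)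
  have hsem : ‖g x‖ ^ i.1 * ‖iteratedFDeriv ℝ i.2 f (g x)‖ ≤ schwartzNorm M f :=
    (SchwartzMap.le_seminorm ℂ i.1 i.2 f (g x)).trans (seminorm_le_schwartzNorm hk hl f)
  calc ‖x‖ ^ i.1 * ‖(iteratedFDeriv ℝ i.2 f (g x)).compContinuousLinearMap fun _ => (g : D →L[ℝ] V)‖
      ≤ (c * ‖g x‖) ^ i.1 * (‖iteratedFDeriv ℝ i.2 f (g x)‖ * c ^ i.2) := by gcongr
    _ = c ^ i.1 * c ^ i.2 * (‖g x‖ ^ i.1 * ‖iteratedFDeriv ℝ i.2 f (g x)‖) := by rw [mul_pow]; ring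
    _ ≤ c ^ M * c ^ M * schwartzNorm M f :=
        mul_le_mul (mul_le_mul (pow_le_pow_right₀ hc1 hk) (pow_le_pow_right₀ hc1 hl)
          (pow_nonneg hc0 _) (pow_nonneg hc0 _)) hsem (by positivity) (by positivity)
    _ = c ^ (2 * M) * schwartzNorm M f := by rw [two_mul, pow_add]

/-- **Schwartz decay of the Fourier transform, in Schwartz-norm form**: for every `N` there are
`M, C` with `(1 + ‖ξ‖)^N ‖𝓕G(ξ)‖ ≤ C |G|_M` for all `G ∈ 𝓢(ℝ^ι)` (continuity of `𝓕` on `𝓢`,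
`Seminorm.bound_of_continuous`). [folklore] -/
theorem exists_fourier_decay_schwartzNorm {ι : Type*} [Fintype ι] (N : ℕ) :
    ∃ (M : ℕ) (C : ℝ), 0 ≤ C ∧ ∀ (G : 𝓢(EuclideanSpace ℝ ι, ℂ)) (ξ : EuclideanSpace ℝ ι),
      (1 + ‖ξ‖) ^ N * ‖𝓕 (G : EuclideanSpace ℝ ι → ℂ) ξ‖ ≤ C * schwartzNorm M G := by
  set Q : Seminorm ℂ 𝓢(EuclideanSpace ℝ ι, ℂ) :=
    ((Finset.Iic (N, 0)).sup (schwartzSeminormFamily ℂ (EuclideanSpace ℝ ι) ℂ)).comp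
      (SchwartzMap.fourierTransformCLM ℂ :
        𝓢(EuclideanSpace ℝ ι, ℂ) →L[ℂ] 𝓢(EuclideanSpace ℝ ι, ℂ)).toLinearMap with hQ_def
  have hQ : Continuous Q := by
    rw [hQ_def, Seminorm.coe_comp]
    exact (Seminorm.continuous_finsetSup fun i _ =>
      (schwartz_withSeminorms ℂ (EuclideanSpace ℝ ι) ℂ).continuous_seminorm i).comp
        (SchwartzMap.fourierTransformCLM ℂ).continuous
  obtain ⟨s, C₁, _, hle⟩ := Seminorm.bound_of_continuous
    (schwartz_withSeminorms ℂ (EuclideanSpace ℝ ι) ℂ) Q hQ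
  obtain ⟨M, hM⟩ := sup_seminorm_le_schwartzNorm (V := EuclideanSpace ℝ ι) s
  refine ⟨M, 2 ^ N * C₁, by positivity, fun G ξ => ?_⟩
  have h1 : (1 + ‖ξ‖) ^ N * ‖𝓕 (G : EuclideanSpace ℝ ι → ℂ) ξ‖ ≤ 2 ^ N * Q G := by
    have h := SchwartzMap.one_add_le_sup_seminorm_apply (𝕜 := ℂ) (m := (N, 0)) (k := N) (n := 0)
      le_rfl le_rfl (𝓕 G) ξ
    rw [norm_iteratedFDeriv_zero] at h
    rw [← SchwartzMap.fourier_coe]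
    exact h
  have h2 : Q G ≤ C₁ * schwartzNorm M G := by
    have h := hle G
    simp only [smul_apply, NNReal.smul_def, smul_eq_mul] at h
    exact h.trans (mul_le_mul_of_nonneg_left (hM G) C₁.coe_nonneg)
  calc (1 + ‖ξ‖) ^ N * ‖𝓕 (G : EuclideanSpace ℝ ι → ℂ) ξ‖ ≤ 2 ^ N * Q G := h1
    _ ≤ 2 ^ N * (C₁ * schwartzNorm M G) := by gcongr
    _ = 2 ^ N * C₁ * schwartzNorm M G := by ring

end Generic

/-! ### Estimates for the expansion -/

section Bounds

variable {E : Type*} [NormedAddCommGroup E] [NormedSpace ℝ E] [FiniteDimensional ℝ E] {m : ℕ}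
  (Λ : E ≃L[ℝ] EuclideanSpace ℝ (Fin m))

omit [FiniteDimensional ℝ E] in
/-- Integer coordinates are controlled by the lattice point: `|β_c| ≤ ‖Λ‖ ‖Λ⁻¹β‖`. [folklore] -/
theorem abs_coord_le_norm_latVec (β : Fin m → ℤ) (c : Fin m) :
    |(β c : ℝ)| ≤ ‖(Λ : E →L[ℝ] EuclideanSpace ℝ (Fin m))‖ * ‖latVec Λ β‖ := by
  calc |(β c : ℝ)| ≤ ‖intVec β‖ := abs_le_norm_intVec β c
    _ = ‖Λ (latVec Λ β)‖ := by rw [latVec, ContinuousLinearEquiv.apply_symm_apply]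
    _ ≤ ‖(Λ : E →L[ℝ] EuclideanSpace ℝ (Fin m))‖ * ‖latVec Λ β‖ := Λ.toContinuousLinearMap.le_opNorm _

omit [FiniteDimensional ℝ E] in
/-- Hence `1 + |β_c| ≤ (1 + ‖Λ‖)(1 + ‖Λ⁻¹β‖)`. [folklore] -/
theorem one_add_abs_le (β : Fin m → ℤ) (c : Fin m) :
    1 + |(β c : ℝ)| ≤ (1 + ‖(Λ : E →L[ℝ] EuclideanSpace ℝ (Fin m))‖) * (1 + ‖latVec Λ β‖) := by
  have h1 := abs_coord_le_norm_latVec Λ β c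
  nlinarith [norm_nonneg (Λ : E →L[ℝ] EuclideanSpace ℝ (Fin m)), norm_nonneg (latVec Λ β)]

omit [FiniteDimensional ℝ E] in
/-- The shifts grow at most linearly: `1 + ‖w_β‖ ≤ C₁ (1 + ‖Λ⁻¹β‖)`. [folklore] -/
theorem one_add_norm_cubeShift_le (β : Fin m → ℤ) :
    1 + ‖cubeShift β‖ ≤ (1 + √m * (2 + ‖(Λ : E →L[ℝ] EuclideanSpace ℝ (Fin m))‖)) * (1 + ‖latVec Λ β‖) := by
  set A : ℝ := ‖(Λ : E →L[ℝ] EuclideanSpace ℝ (Fin m))‖ with hA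
  set a : ℝ := ‖latVec Λ β‖ with ha
  have hA0 : 0 ≤ A := norm_nonneg _
  have ha0 : 0 ≤ a := norm_nonneg _
  have hcoord : ∀ c, |cubeShift β c| ≤ 2 + A * a := by
    intro c
    rw [cubeShift_apply, abs_div, abs_of_pos (by norm_num : (0 : ℝ) < 4)]
    have h1 : |(2 : ℝ) - β c| ≤ 2 + |(β c : ℝ)| := by
      calc |(2 : ℝ) - β c| ≤ |(2 : ℝ)| + |(β c : ℝ)| := abs_sub _ _
        _ = 2 + |(β c : ℝ)| := by norm_num
    have h2 : |(β c : ℝ)| ≤ A * a := abs_coord_le_norm_latVec Λ β c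
    have h3 : |(2 : ℝ) - β c| / 4 ≤ |(2 : ℝ) - β c| := div_le_self (abs_nonneg _) (by norm_num)
    linarith
  have hn : ‖cubeShift β‖ ≤ √m * (2 + A * a) := by
    simpa using EuclideanSpace.norm_le_sqrt_card_mul (cubeShift β) (by positivity) hcoord
  have hm0 : 0 ≤ √(m : ℝ) := Real.sqrt_nonneg _
  nlinarith [mul_nonneg hm0 hA0, mul_nonneg (mul_nonneg hm0 hA0) ha0, mul_nonneg hm0 ha0]

/-- **Decay of the localised pieces**: `|η_β ψ|_M (1 + ‖Λ⁻¹β‖)^N ≤ C |ψ|_t` — a Schwartz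
function is small, with all derivatives, on the support of `η_β` far from the origin
(`exists_bound_sup_seminorm_smulLeftCLM_compSubConstCLM` after writing `η_β ψ` as a translate,
`eta_eq_translate`). [folklore] -/
theorem exists_bound_schwartzNorm_eta (M N : ℕ) :
    ∃ (t : ℕ) (C : ℝ), 0 ≤ C ∧ ∀ (β : Fin m → ℤ) (ψ : 𝓢(E, ℂ)),
      schwartzNorm M (eta Λ β ψ) * (1 + ‖latVec Λ β‖) ^ N ≤ C * schwartzNorm t ψ := by
  obtain ⟨C, s', hC0, hC⟩ := exists_bound_sup_seminorm_smulLeftCLM_compSubConstCLM ℂ (F := ℂ)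
    (contDiff_etaFun Λ 0) (hasCompactSupport_etaFun Λ 0) (Finset.Iic (M, M)) (N + M)
  obtain ⟨t, ht⟩ := sup_seminorm_le_schwartzNorm (V := E) s'
  refine ⟨t, 2 ^ M * C, by positivity, fun β ψ => ?_⟩
  set a : E := latVec Λ β with ha
  set h : 𝓢(E, ℂ) := eta Λ 0 (SchwartzMap.compSubConstCLM ℂ (-a) ψ) with hh
  have ha1 : (1 : ℝ) ≤ 1 + ‖a‖ := le_add_of_nonneg_right (norm_nonneg _)
  -- the localised piece around the origin decays in `‖a‖`
  have hloc : schwartzNorm M h * (1 + ‖a‖) ^ (N + M) ≤ C * schwartzNorm t ψ := by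
    have h1 := hC (-a) ψ
    rw [norm_neg] at h1
    exact h1.trans (mul_le_mul_of_nonneg_left (ht ψ) hC0)
  -- translate back
  have htr : schwartzNorm M (eta Λ β ψ) ≤ (2 * (1 + ‖a‖)) ^ M * schwartzNorm M h := by
    rw [eta_eq_translate]
    exact schwartzNorm_compSubConstCLM_le M a h
  calc schwartzNorm M (eta Λ β ψ) * (1 + ‖a‖) ^ N
      ≤ (2 * (1 + ‖a‖)) ^ M * schwartzNorm M h * (1 + ‖a‖) ^ N := by gcongr
    _ = 2 ^ M * (schwartzNorm M h * (1 + ‖a‖) ^ (N + M)) := by rw [mul_pow, pow_add]; ring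
    _ ≤ 2 ^ M * (C * schwartzNorm t ψ) := by gcongr
    _ = 2 ^ M * C * schwartzNorm t ψ := by ring

/-- **Rapid decay of the coefficients**: for every `N` there are `t, C` with
`‖coeff_{β,k}(ψ)‖ (1 + |k|₁)^N (1 + ‖Λ⁻¹β‖)^N ≤ C |ψ|_t` for all `β, k ∈ ℤᵐ`, `ψ ∈ 𝓢(E, ℂ)`
(Fourier decay of the transported localised piece; the polynomial losses from the transport to the
unit cube are absorbed by the decay of `η_β ψ`). In Summers' proof this is the decay (A6) of the
Hermite coefficients. [folklore] -/
theorem norm_coeff_mul_pow_le (N : ℕ) :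
    ∃ (t : ℕ) (C : ℝ), 0 ≤ C ∧ ∀ (β k : Fin m → ℤ) (ψ : 𝓢(E, ℂ)),
      ‖coeff Λ β k ψ‖ * (1 + absSum k) ^ N * (1 + ‖latVec Λ β‖) ^ N ≤ C * schwartzNorm t ψ := by
  -- Fourier decay
  obtain ⟨M, C_F, hC_F, hF⟩ := exists_fourier_decay_schwartzNorm (ι := Fin m) N
  -- localisation decay with the exponent needed to absorb the transport losses
  obtain ⟨t, C_loc, hC_loc, hloc⟩ := exists_bound_schwartzNorm_eta Λ M (N + M)
  -- constants
  set cι : ℝ := max (m : ℝ) 1 with hcι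
  set L : E ≃L[ℝ] EuclideanSpace ℝ (Fin m) := cubeCoord Λ with hL
  set c_L : ℝ := (max 1 (max ‖(L.symm.symm : E →L[ℝ] EuclideanSpace ℝ (Fin m))‖
    ‖(L.symm : EuclideanSpace ℝ (Fin m) →L[ℝ] E)‖)) ^ (2 * M) with hc_L
  set C₁ : ℝ := 1 + √m * (2 + ‖(Λ : E →L[ℝ] EuclideanSpace ℝ (Fin m))‖) with hC₁
  have hC₁0 : 0 ≤ C₁ := by positivity
  refine ⟨t, cι ^ N * C_F * ((2 * C₁) ^ M * c_L) * C_loc, by positivity, fun β k ψ => ?_⟩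
  set a : ℝ := ‖latVec Λ β‖ with ha
  have ha0 : 0 ≤ a := norm_nonneg _
  set g : 𝓢(E, ℂ) := eta Λ β ψ with hg
  set h : 𝓢(EuclideanSpace ℝ (Fin m), ℂ) := toCube L (cubeShift β) g with hh
  -- (a) `|k|₁` against `‖intVec k‖`
  have hk : 1 + absSum k ≤ cι * (1 + ‖intVec k‖) := by
    calc 1 + absSum k ≤ 1 + m * ‖intVec k‖ := by
          gcongr; simpa using absSum_le_card_mul_norm k
      _ ≤ cι * 1 + cι * ‖intVec k‖ := by
          gcongr
          · linarith [le_max_right (m : ℝ) 1]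
          · exact le_max_left _ _
      _ = cι * (1 + ‖intVec k‖) := by ring
  -- (b) Fourier decay
  have hb : ‖coeff Λ β k ψ‖ * (1 + ‖intVec k‖) ^ N ≤ C_F * schwartzNorm M h := by
    rw [coeff_apply, boxCoeff, mul_comm]
    exact hF h (intVec k)
  -- (c) transport losses
  have hc : schwartzNorm M h ≤ (2 * C₁) ^ M * c_L * (1 + a) ^ M * schwartzNorm M g := by
    have h1 : schwartzNorm M h ≤ (2 * (1 + ‖cubeShift β‖)) ^ M *
        schwartzNorm M (SchwartzMap.compCLMOfContinuousLinearEquiv ℂ L.symm g) :=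
      schwartzNorm_compSubConstCLM_le M (cubeShift β) _
    have h2 : schwartzNorm M (SchwartzMap.compCLMOfContinuousLinearEquiv ℂ L.symm g) ≤
        c_L * schwartzNorm M g := schwartzNorm_compCLMOfContinuousLinearEquiv_le M L.symm g
    have h3 : 2 * (1 + ‖cubeShift β‖) ≤ 2 * C₁ * (1 + a) := by
      rw [mul_assoc]
      exact mul_le_mul_of_nonneg_left (one_add_norm_cubeShift_le Λ β) zero_le_two
    have hcL0 : 0 ≤ c_L * schwartzNorm M g := mul_nonneg (by positivity) (schwartzNorm_nonneg _ _)
    calc schwartzNorm M h ≤ (2 * (1 + ‖cubeShift β‖)) ^ M * (c_L * schwartzNorm M g) :=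
          h1.trans (mul_le_mul_of_nonneg_left h2 (by positivity))
      _ ≤ (2 * C₁ * (1 + a)) ^ M * (c_L * schwartzNorm M g) :=
          mul_le_mul_of_nonneg_right (pow_le_pow_left₀ (by positivity) h3 M) hcL0
      _ = (2 * C₁) ^ M * c_L * (1 + a) ^ M * schwartzNorm M g := by rw [mul_pow]; ring
  -- (d) localisation decay
  have hd : schwartzNorm M g * (1 + a) ^ (N + M) ≤ C_loc * schwartzNorm t ψ := hloc β ψ
  -- assemble
  have hcoeff0 : 0 ≤ ‖coeff Λ β k ψ‖ := norm_nonneg _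
  calc ‖coeff Λ β k ψ‖ * (1 + absSum k) ^ N * (1 + a) ^ N
      ≤ ‖coeff Λ β k ψ‖ * (cι * (1 + ‖intVec k‖)) ^ N * (1 + a) ^ N := by
        gcongr
        exact add_nonneg zero_le_one (absSum_nonneg k)
    _ = cι ^ N * (‖coeff Λ β k ψ‖ * (1 + ‖intVec k‖) ^ N) * (1 + a) ^ N := by rw [mul_pow]; ring
    _ ≤ cι ^ N * (C_F * schwartzNorm M h) * (1 + a) ^ N := by gcongr
    _ ≤ cι ^ N * (C_F * ((2 * C₁) ^ M * c_L * (1 + a) ^ M * schwartzNorm M g)) * (1 + a) ^ N := by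
        gcongr
    _ = cι ^ N * C_F * ((2 * C₁) ^ M * c_L) * (schwartzNorm M g * (1 + a) ^ (N + M)) := by
        rw [pow_add]; ring
    _ ≤ cι ^ N * C_F * ((2 * C₁) ^ M * c_L) * (C_loc * schwartzNorm t ψ) := by gcongr
    _ = cι ^ N * C_F * ((2 * C₁) ^ M * c_L) * C_loc * schwartzNorm t ψ := by ring

/-- **Polynomial growth of the elementary functions at the origin**:
`‖P₀ e_k‖_{k',l'} ≤ K (1 + |k|₁)^{l'}` (Leibniz rule with the window and
`‖Dʲ e_k‖ ≤ (2π|k|₁‖L‖)ʲ`, as in `BoxData.seminorm_charFactorS_le`). [folklore] -/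
theorem seminorm_char0_le (k' l' : ℕ) :
    ∃ K : ℝ, 0 ≤ K ∧ ∀ k : Fin m → ℤ,
      SchwartzMap.seminorm ℂ k' l' (char0 Λ k) ≤ K * (1 + absSum k) ^ l' := by
  set P : 𝓢(E, ℂ) := win Λ with hP
  set Lc : E →L[ℝ] EuclideanSpace ℝ (Fin m) := (cubeCoord Λ : E →L[ℝ] EuclideanSpace ℝ (Fin m))
  set c₀ : ℝ := max (2 * π * ‖Lc‖) 1 with hc₀
  have hc₀1 : 1 ≤ c₀ := le_max_right _ _
  have hc₀0 : 0 ≤ c₀ := zero_le_one.trans hc₀1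
  set K : ℝ := ∑ j ∈ Finset.range (l' + 1), (l'.choose j : ℝ) * SchwartzMap.seminorm ℂ k' j P * c₀ ^ l'
    with hK
  refine ⟨K, Finset.sum_nonneg fun j _ => mul_nonneg (mul_nonneg (Nat.cast_nonneg _)
    (apply_nonneg _ _)) (pow_nonneg hc₀0 _), fun k => ?_⟩
  set a : ℝ := absSum k with ha
  have ha0 : 0 ≤ a := absSum_nonneg k
  let T : E → ℂ := fun x => eChar k (Lc x + cubeShift 0)
  have hT : ContDiff ℝ (⊤ : ℕ∞) T := contDiff_eChar_affine Lc (cubeShift 0) k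
  have hε : ∀ j ≤ l', ∀ x, ‖iteratedFDeriv ℝ j T x‖ ≤ (c₀ * a) ^ j := by
    intro j _ x
    refine (norm_iteratedFDeriv_eChar_affine_le Lc (cubeShift 0) k j x).trans ?_
    refine pow_le_pow_left₀ (mul_nonneg (mul_nonneg (by positivity) (absSum_nonneg _))
      (norm_nonneg _)) ?_ j
    calc 2 * π * absSum k * ‖Lc‖ = (2 * π * ‖Lc‖) * a := by rw [ha]; ring
      _ ≤ c₀ * a := mul_le_mul_of_nonneg_right (le_max_left _ _) ha0
  have hfun : (char0 Λ k : E → ℂ) = fun x => P x * T x := funext fun x => by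
    rw [char0_apply]; rfl
  have ha1 : 0 ≤ 1 + a := by linarith
  refine SchwartzMap.seminorm_le_bound ℂ k' l' _ (mul_nonneg (Finset.sum_nonneg fun j _ =>
    mul_nonneg (mul_nonneg (Nat.cast_nonneg _) (apply_nonneg _ _)) (pow_nonneg hc₀0 _))
    (pow_nonneg ha1 _)) fun x => ?_
  rw [hfun]
  refine (pow_mul_norm_iteratedFDeriv_mul_le P hT hε k' x).trans ?_
  rw [hK, Finset.sum_mul]
  refine Finset.sum_le_sum fun j hj => ?_
  have h1 : (c₀ * a) ^ (l' - j) ≤ c₀ ^ l' * (1 + a) ^ l' := by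
    rw [mul_pow]
    refine mul_le_mul (pow_le_pow_right₀ hc₀1 (Nat.sub_le l' j))
      ((pow_le_pow_left₀ ha0 (by linarith) _).trans (pow_le_pow_right₀ (by linarith) (Nat.sub_le l' j)))
      (pow_nonneg ha0 _) (pow_nonneg hc₀0 _)
  calc (l'.choose j : ℝ) * SchwartzMap.seminorm ℂ k' j P * (c₀ * a) ^ (l' - j)
      ≤ (l'.choose j : ℝ) * SchwartzMap.seminorm ℂ k' j P * (c₀ ^ l' * (1 + a) ^ l') :=
        mul_le_mul_of_nonneg_left h1 (mul_nonneg (Nat.cast_nonneg _) (apply_nonneg _ _))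
    _ = (l'.choose j : ℝ) * SchwartzMap.seminorm ℂ k' j P * c₀ ^ l' * (1 + a) ^ l' := by ring

/-- **Polynomial growth of the Schwartz norms of the elementary functions**:
`|e_{β,k}|_s ≤ C (1 + |k|₁)^s (1 + ‖Λ⁻¹β‖)^s` (growth at the origin and polynomial growth of
translates). In Summers' proof this is the growth (A4)–(A5) of the Hermite functions. [folklore] -/
theorem schwartzNorm_e_le (s : ℕ) :
    ∃ C : ℝ, 0 ≤ C ∧ ∀ β k : Fin m → ℤ,
      schwartzNorm s (e Λ β k) ≤ C * (1 + absSum k) ^ s * (1 + ‖latVec Λ β‖) ^ s := by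
  choose K hK0 hK using fun p : ℕ × ℕ => seminorm_char0_le Λ p.1 p.2
  set K₀ : ℝ := ∑ p ∈ Finset.Iic (s, s), K p with hK₀
  have hK₀0 : 0 ≤ K₀ := Finset.sum_nonneg fun p _ => hK0 p
  refine ⟨2 ^ s * K₀, by positivity, fun β k => ?_⟩
  have ha1 : (1 : ℝ) ≤ 1 + absSum k := le_add_of_nonneg_right (absSum_nonneg k)
  have h0 : schwartzNorm s (char0 Λ k) ≤ K₀ * (1 + absSum k) ^ s := by
    refine Seminorm.finset_sup_apply_le (mul_nonneg hK₀0 (pow_nonneg (zero_le_one.trans ha1) _))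
      fun p hp => ?_
    obtain ⟨_, hl⟩ := Prod.mk_le_mk.1 (Finset.mem_Iic.1 hp)
    rw [SchwartzMap.schwartzSeminormFamily_apply]
    calc SchwartzMap.seminorm ℂ p.1 p.2 (char0 Λ k) ≤ K p * (1 + absSum k) ^ p.2 := hK p k
      _ ≤ K p * (1 + absSum k) ^ s := mul_le_mul_of_nonneg_left (pow_le_pow_right₀ ha1 hl) (hK0 p)
      _ ≤ K₀ * (1 + absSum k) ^ s :=
          mul_le_mul_of_nonneg_right (Finset.single_le_sum (fun q _ => hK0 q) hp) (by positivity)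
  calc schwartzNorm s (e Λ β k) ≤ (2 * (1 + ‖latVec Λ β‖)) ^ s * schwartzNorm s (char0 Λ k) :=
        schwartzNorm_compSubConstCLM_le s _ _
    _ ≤ (2 * (1 + ‖latVec Λ β‖)) ^ s * (K₀ * (1 + absSum k) ^ s) := by gcongr
    _ = 2 ^ s * K₀ * (1 + absSum k) ^ s * (1 + ‖latVec Λ β‖) ^ s := by rw [mul_pow]; ring

/-- The weights `(1 + |k|₁)^{-2m}` are summable over `ℤᵐ` (against `∏_c (1 + |k_c|)⁻²`). [folklore] -/
theorem summable_inv_one_add_absSum_pow :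
    Summable fun k : Fin m → ℤ => ((1 + absSum k) ^ (2 * m))⁻¹ := by
  refine Summable.of_nonneg_of_le
    (fun k => inv_nonneg.2 (pow_nonneg (add_nonneg zero_le_one (absSum_nonneg k)) _)) (fun k => ?_)
    (summable_pi_inv_one_add_abs_sq (ι := Fin m))
  have hprod_pos : 0 < ∏ c, (1 + |(k c : ℝ)|) ^ 2 := Finset.prod_pos fun c _ => by positivity
  rw [Finset.prod_inv_distrib]
  refine inv_anti₀ hprod_pos ?_
  calc ∏ c, (1 + |(k c : ℝ)|) ^ 2 ≤ ∏ _c : Fin m, (1 + absSum k) ^ 2 :=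
        Finset.prod_le_prod (fun c _ => by positivity) fun c _ =>
          pow_le_pow_left₀ (by positivity) (by linarith [abs_le_absSum k c]) 2
    _ = (1 + absSum k) ^ (2 * m) := by
        rw [Finset.prod_const, Finset.card_univ, Fintype.card_fin, ← pow_mul, mul_comm]

omit [FiniteDimensional ℝ E] in
/-- The weights `(1 + ‖Λ⁻¹β‖)^{-2m}` are summable over `ℤᵐ`. [folklore] -/
theorem summable_inv_one_add_norm_latVec_pow :
    Summable fun β : Fin m → ℤ => ((1 + ‖latVec Λ β‖) ^ (2 * m))⁻¹ := by
  set A : ℝ := ‖(Λ : E →L[ℝ] EuclideanSpace ℝ (Fin m))‖ with hA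
  refine Summable.of_nonneg_of_le (fun β => by positivity) (fun β => ?_)
    ((summable_pi_inv_one_add_abs_sq (ι := Fin m)).mul_left ((1 + A) ^ (2 * m)))
  have hprod_pos : 0 < ∏ c, (1 + |(β c : ℝ)|) ^ 2 := Finset.prod_pos fun c _ => by positivity
  have hpos : 0 < (1 + ‖latVec Λ β‖) ^ (2 * m) := by positivity
  rw [Finset.prod_inv_distrib, ← div_eq_mul_inv, le_div_iff₀ hprod_pos, inv_mul_le_iff₀ hpos]
  calc ∏ c, (1 + |(β c : ℝ)|) ^ 2 ≤ ∏ _c : Fin m, ((1 + A) * (1 + ‖latVec Λ β‖)) ^ 2 :=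
        Finset.prod_le_prod (fun c _ => by positivity) fun c _ =>
          pow_le_pow_left₀ (by positivity) (one_add_abs_le Λ β c) 2
    _ = (1 + ‖latVec Λ β‖) ^ (2 * m) * (1 + A) ^ (2 * m) := by
        rw [Finset.prod_const, Finset.card_univ, Fintype.card_fin, ← pow_mul, mul_comm 2 m,
          mul_pow, mul_comm]

/-- **The expansion is nuclear**: for every order `s` there are an order `t` and nonnegative
weights `L_{β,k}` with `‖coeff_{β,k}(ψ)‖ ≤ L_{β,k} |ψ|_t` for all `ψ` and
`∑_{(β,k) ∈ ℤᵐ × ℤᵐ} L_{β,k} |e_{β,k}|_s < ∞`. This is the quantitative content of the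
nuclearity of `𝒮` (Grothendieck's form) used in Summers' proof of E0'' ⇒ E0'. [folklore] -/
theorem exists_summable_bound (s : ℕ) :
    ∃ (t : ℕ) (L : (Fin m → ℤ) → (Fin m → ℤ) → ℝ), (∀ β k, 0 ≤ L β k) ∧
      (∀ (β k : Fin m → ℤ) (ψ : 𝓢(E, ℂ)), ‖coeff Λ β k ψ‖ ≤ L β k * schwartzNorm t ψ) ∧
      Summable fun p : (Fin m → ℤ) × (Fin m → ℤ) => L p.1 p.2 * schwartzNorm s (e Λ p.1 p.2) := by
  obtain ⟨t, C, hC0, hC⟩ := norm_coeff_mul_pow_le Λ (s + 2 * m)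
  obtain ⟨C_e, hC_e0, hC_e⟩ := schwartzNorm_e_le Λ s
  set w : (Fin m → ℤ) → (Fin m → ℤ) → ℝ := fun β k =>
    (1 + absSum k) ^ (s + 2 * m) * (1 + ‖latVec Λ β‖) ^ (s + 2 * m) with hw
  have hw_pos : ∀ β k, 0 < w β k := fun β k => by
    have := absSum_nonneg k
    positivity
  refine ⟨t, fun β k => C / w β k, fun β k => div_nonneg hC0 (hw_pos β k).le, fun β k ψ => ?_, ?_⟩
  · rw [div_mul_eq_mul_div, le_div_iff₀ (hw_pos β k)]
    calc ‖coeff Λ β k ψ‖ * w β k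
        = ‖coeff Λ β k ψ‖ * (1 + absSum k) ^ (s + 2 * m) * (1 + ‖latVec Λ β‖) ^ (s + 2 * m) := by
          rw [hw]; ring
      _ ≤ C * schwartzNorm t ψ := hC β k ψ
  · have hdom : ∀ p : (Fin m → ℤ) × (Fin m → ℤ),
        C / w p.1 p.2 * schwartzNorm s (e Λ p.1 p.2) ≤
          C * C_e * (((1 + ‖latVec Λ p.1‖) ^ (2 * m))⁻¹ * ((1 + absSum p.2) ^ (2 * m))⁻¹) := by
      rintro ⟨β, k⟩
      have hk0 : 0 < 1 + absSum k := by linarith [absSum_nonneg k]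
      have hb0 : 0 < 1 + ‖latVec Λ β‖ := by positivity
      dsimp only
      calc C / w β k * schwartzNorm s (e Λ β k)
          ≤ C / w β k * (C_e * (1 + absSum k) ^ s * (1 + ‖latVec Λ β‖) ^ s) :=
            mul_le_mul_of_nonneg_left (hC_e β k) (div_nonneg hC0 (hw_pos β k).le)
        _ = C * C_e * (((1 + ‖latVec Λ β‖) ^ (2 * m))⁻¹ * ((1 + absSum k) ^ (2 * m))⁻¹) := by
            rw [hw]
            field_simp
            ring
    refine Summable.of_nonneg_of_le (fun p => mul_nonneg (div_nonneg hC0 (hw_pos _ _).le)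
      (schwartzNorm_nonneg _ _)) hdom ?_
    exact ((summable_inv_one_add_norm_latVec_pow Λ).mul_of_nonneg (summable_inv_one_add_absSum_pow (m := m))
      (fun β => by positivity)
      (fun k => inv_nonneg.2 (pow_nonneg (add_nonneg zero_le_one (absSum_nonneg k)) _))).mul_left (C * C_e)

end Bounds

end NuclearExpansion

end Literature.MathematicalPhysics.QuantumLattice
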